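import Summits.BirchSwinnertonDyer.BirchSwinnertonDyer.Theorems.KimAtThreePortSharedC2GL2
import Summits.BirchSwinnertonDyer.Rank1Residual.GaloisImage.EisensteinPrimeInProgression
import Literature.NumberTheory.EllipticCurves.SerreOpenImageDeterminantProofs
import Literature.NumberTheory.GaloisRepresentations.ChebotarevArtinRep
import HarnessLib

/-!
# surj(3) ⇒ a good prime `q` in ANY class `u (mod M)` with `3 ∤ #Ẽ(𝔽_q)` — the Chebotarev supply
# of non-anomalous auxiliary primes for the certificate input (C2′) of crux
# `KatoKuriharaPortThreeShared` (stmt-BirchSwinnertonDyer-19560; cell `bsd-addord`, seat w2-c3 gen 4)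

Route W2 `KimAtThreeKolyvagin`, §U child 19560 of crux 19076 `DeepUpperAtThree`.  kim3 gen 10
reduced the crux BY NAME to three displayed inputs (C1)/(C2)/(C3) (`Theorems/KimAtThreeKolyvaginPortShared.lean`)
and (C2) to the one-number certificate (C2′) (`Theorems/KimAtThreeKolyvaginPortSharedCert.lean`):
per row, a prime `q ≡ 2 (mod 3)`, `q ∤ N`, with `3 ∤ q + 1 − a_q` and a `3`-adic UNIT minus modular
symbol `[a₀/qⁿ]⁻` of the newform.  This file supplies the GALOIS half of a class-wide proof of
(C2′): for an elliptic curve `E = W/ℚ` (globally minimal) with `ρ̄_{E,3} : Γ_ℚ → Aut(E[3])` ONTO,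
every modulus `M ≥ 1`, every unit `u ∈ (ℤ/M)ˣ` and every finite set `S` of primes, there is a
prime `q ∉ S`, `q ≠ 3`, of good reduction with `q ≡ u (mod M)` and `3 ∤ #Ẽ(𝔽_q)` (equivalently
`a_q(E) ≢ q + 1 (mod 3)`): `exists_prime_cast_eq_not_dvd_reductionPointCount_of_surj`.

## Proof (all inputs are tree THEOREMS)

* (`GL₂(𝔽₃)`, file `Theorems/KimAtThreePortSharedC2GL2.lean`) every coset of the commutator subgroup
  of `GL₂(𝔽₃)` contains an element without the eigenvalue `1` (`SL₂(𝔽₃) ≤ [GL₂(𝔽₃), GL₂(𝔽₃)]` by a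
  Bruhat-type factorisation into transvections, each a commutator; `−1` resp. `(1 1; 1 0)` per
  determinant class): `KimAtThreePortSharedC2GL2.exists_mem_commutator_mul_forall_mulVec_ne`.
* (§1) With the frame `Φ : Aut(E[3]) ≅ GL₂(𝔽₃)` (`exists_frame_galoisRepTorsion_rat`), the
  surjections `ρ̄_{E,3}` (hypothesis) and `χ_M : Γ_ℚ ↠ (ℤ/M)ˣ` (`modNCyclotomicCharacter_rat_surjective`)
  and `[Γ_ℚ, Γ_ℚ] ≤ ker χ_M` (`commutator_le_ker_modNCyclotomicCharacter`): pick `σ₁` with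
  `χ_M(σ₁) = u`, then `τ ∈ [Γ_ℚ, Γ_ℚ]` mapping to that commutator-subgroup element `C` for
  `B = Φ(ρ̄ σ₁)`; `σ = σ₁ τ` has `χ_M(σ) = u` and `ρ̄(σ)` fixes no non-zero point of `E[3]`.
* (§2) **Chebotarev's density theorem** (existence form, PROVED in the tree:
  `chebotarevArtinRep_holds` / `FramedArtinRep.infinite_setOf_isArithFrobAt_apply_eq`) for the
  permutation Artin representation of `Γ_ℚ` on `E[3] × (ℤ/M)ˣ`
  (`exists_framedArtinRep_geomTorsion_prod_cyclotomic`, n1011) and `σ`: infinitely many places carry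
  an arithmetic Frobenius `Φ_v` acting on `E[3]` as `σ` and with `χ_M(Φ_v) = χ_M(σ) = u`; discard the
  places over `S ∪ {3} ∪ {ℓ ∣ Δ_min} ∪ {ℓ ∣ M}`; then `q ≡ u (mod M)`
  (`modNCyclotomicCharacter_eq_residueCard_of_isArithFrobAt`), and `3 ∣ #Ẽ(𝔽_q)` would give a
  non-zero `P ∈ E[3]` fixed by `Φ_v` (`exists_frobenius_smul_eq_of_dvd_reductionPointCount_holds`),
  i.e. by `σ` — impossible.  This is n1011's `exists_prime_one_mod_not_dvd_reductionPointCount`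
  (class `u = 1`, Frobenius' division theorem) with Chebotarev in place of Frobenius.

HONEST LIMITS: a TOOL theorem about `E[3]`; closes nothing by itself; nothing is booked.
References: J.-P. Serre, Invent. Math. 15 (1972) §2, §5.2 [Serre1972]; J. Tate, *Global class
field theory* §2.4 (Chebotarev) in Cassels–Fröhlich (1967) [TateGCFT1967]; kim3 memo
`HOME/kim3/KIM3-W2-PORT-g10.md` §3 (C2′).
-/

noncomputable section

-- every file of this route lives in `Summit.BirchSwinnertonDyer.BirchSwinnertonDyer.Theorems.*` (summit =
-- problem name), so the duplicated-namespace linter is moot here (as in kim3's `KimAtThreeKolyvaginPortShared`).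
set_option linter.dupNamespace false

open scoped Classical
open NumberField IsDedekindDomain IsDedekindDomain.HeightOneSpectrum Field WeierstrassCurve
  Rat.HeightOneSpectrum Matrix
open Literature.NumberTheory.EllipticCurves Literature.NumberTheory.GaloisRepresentations
open Summit.BirchSwinnertonDyer.Rank1Residual.GaloisImage
open Summit.BirchSwinnertonDyer.BirchSwinnertonDyer.Theorems

namespace Summit.BirchSwinnertonDyer.BirchSwinnertonDyer.Theorems.KimAtThreePortSharedC2Chebotarev


/-! ### §1. A Galois element in a prescribed cyclotomic class fixing no non-zero point of `E[3]` -/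

variable (W : WeierstrassCurve ℚ) [W.IsElliptic]

/-- **surj(3) ⇒ for every unit `u mod M` some `σ ∈ Γ_ℚ` has `χ_M(σ) = u` and fixes no non-zero
point of `E[3]`.**  Frame `Φ : Aut(E[3]) ≅ GL₂(𝔽₃)` (`exists_frame_galoisRepTorsion_rat`); `σ₁` with
`χ_M(σ₁) = u` (`modNCyclotomicCharacter_rat_surjective`); `C` in the commutator subgroup with
`Φ(ρ̄ σ₁)·C` fixed-point-free (`KimAtThreePortSharedC2GL2`); `C = Φ(ρ̄ τ)` for some `τ ∈ [Γ_ℚ, Γ_ℚ]` (surjectivity of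
`Φ ∘ ρ̄_{E,3}` and `Subgroup.map_commutator`), and `χ_M(τ) = 1`
(`commutator_le_ker_modNCyclotomicCharacter`); `σ = σ₁ τ`. [cite: Serre1972, §5.2 (the framed mod-`p` representation)] -/
theorem exists_cyclotomic_eq_forall_smul_ne_of_surj (hs : W.HasSurjectiveModNGaloisRep (3 : ℕ))
    (M : ℕ) [NeZero M] (u : (ZMod M)ˣ) :
    ∃ σ : absoluteGaloisGroup ℚ, modNCyclotomicCharacter ℚ M σ = u ∧
      ∀ P : W.geomTorsion (3 : ℕ), σ • P = P → P = 0 := by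
  haveI : Fact (Nat.Prime 3) := ⟨Nat.prime_three⟩
  obtain ⟨e, Φ, he, -, -, -, -⟩ := exists_frame_galoisRepTorsion_rat W 3
  obtain ⟨σ₁, hσ₁⟩ := modNCyclotomicCharacter_rat_surjective M u
  set f : absoluteGaloisGroup ℚ →* GL (Fin 2) (ZMod 3) :=
    Φ.toMonoidHom.comp (galoisRepTorsion W (3 : ℕ)) with hf
  have hfsurj : Function.Surjective f := by
    intro g
    obtain ⟨x, hx⟩ := hs (Φ.symm g)
    refine ⟨x, ?_⟩
    change Φ (galoisRepTorsion W (3 : ℕ) x) = g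
    rw [hx, MulEquiv.apply_symm_apply]
  obtain ⟨C, hC, hfix⟩ := KimAtThreePortSharedC2GL2.exists_mem_commutator_mul_forall_mulVec_ne (f σ₁)
  -- lift `C` to the commutator subgroup of `Γ_ℚ`
  have hmap : (commutator (absoluteGaloisGroup ℚ)).map f = commutator (GL (Fin 2) (ZMod 3)) := by
    rw [commutator_def, commutator_def, Subgroup.map_commutator, Subgroup.map_top_of_surjective f hfsurj]
  have hC' : C ∈ (commutator (absoluteGaloisGroup ℚ)).map f := by rw [hmap]; exact hC
  obtain ⟨τ, hτ, hτC⟩ := Subgroup.mem_map.mp hC'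
  refine ⟨σ₁ * τ, ?_, fun P hP => ?_⟩
  · rw [map_mul, hσ₁, MonoidHom.mem_ker.mp (commutator_le_ker_modNCyclotomicCharacter M hτ), mul_one]
  · have h1 := he (galoisRepTorsion W (3 : ℕ) (σ₁ * τ)) P
    rw [galoisRepTorsion_apply, hP] at h1
    have h2 : Φ (galoisRepTorsion W (3 : ℕ) (σ₁ * τ)) = f σ₁ * C := by
      rw [← hτC, ← map_mul]; rfl
    rw [h2] at h1
    have h3 : e P = 0 := hfix (e P) h1.symm
    exact (map_eq_zero_iff e e.injective).mp h3

/-! ### §2. Chebotarev: the non-anomalous prime in a prescribed class -/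

/-- **surj(3) ⇒ a good prime `q ≡ u (mod M)`, outside any finite set, with `3 ∤ #Ẽ(𝔽_q)`.**
Let `E = W/ℚ` (globally minimal) with `ρ̄_{E,3}` onto, `M ≥ 1`, `u ∈ (ℤ/M)ˣ`, `S` a finite set of
primes.  Then some prime `q ∉ S`, `q ≠ 3`, of good reduction has `q ≡ u (mod M)` and
`3 ∤ #Ẽ(𝔽_q)`.  Proof: `σ` of `exists_cyclotomic_eq_forall_smul_ne_of_surj`; the permutation Artin
representation `ρ` on `E[3] × (ℤ/M)ˣ` (`exists_framedArtinRep_geomTorsion_prod_cyclotomic`); by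
**Chebotarev** (`FramedArtinRep.infinite_setOf_isArithFrobAt_apply_eq`, PROVED in the tree) some
place `v` outside `S ∪ {3} ∪ {ℓ ∣ Δ_min} ∪ {ℓ ∣ M}` has an arithmetic Frobenius `Φ` with
`ρ Φ = ρ σ`; so `χ_M Φ = χ_M σ = u`, i.e. `q ≡ u (mod M)` (`χ_M(Frob_q) = q`), and `3 ∣ #Ẽ(𝔽_q)`
would give a non-zero `P ∈ E[3]` fixed by `Φ` (reduction of torsion), hence by `σ` — impossible.
[cite: TateGCFT1967, §2.4 (Tchebotarev density theorem)] [cite: Serre1972, §5.2] -/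
theorem exists_prime_cast_eq_not_dvd_reductionPointCount_of_surj [W.IsGloballyMinimal]
    (hs : W.HasSurjectiveModNGaloisRep (3 : ℕ)) (M : ℕ) [NeZero M] (u : (ZMod M)ˣ)
    (S : Set ℕ) (hS : S.Finite) :
    ∃ (ℓ : ℕ) (_ : Fact ℓ.Prime), ℓ ∉ S ∧ ℓ ≠ 3 ∧ W.HasGoodReductionAtPrime ℓ ∧
      (ℓ : ZMod M) = (u : ZMod M) ∧ ¬ 3 ∣ W.reductionPointCount ℓ := by
  haveI : Fact (Nat.Prime 3) := ⟨Nat.prime_three⟩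
  haveI : NeZero ((M : ℕ) : ℚ) := ⟨Nat.cast_ne_zero.mpr (NeZero.ne M)⟩
  set χ := modNCyclotomicCharacter ℚ M with hχdef
  obtain ⟨σ, hσχ, hσ⟩ := exists_cyclotomic_eq_forall_smul_ne_of_surj W hs M u
  obtain ⟨m, ρ, -, hfaith⟩ :=
    exists_framedArtinRep_geomTorsion_prod_cyclotomic W (n := ((3 : ℕ) : ℤ)) (by norm_num) M
  -- the excluded primes
  have hΔ0 : minimalDiscriminantInt W ≠ 0 := minimalDiscriminantInt_ne_zero W
  let S' : Set ℕ := S ∪ {ℓ | ℓ = 3 ∨ (ℓ : ℤ) ∣ minimalDiscriminantInt W ∨ ℓ ∣ M}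
  have hS' : S'.Finite := by
    refine hS.union ((Set.finite_le_nat (max 3 (max (minimalDiscriminantInt W).natAbs M))).subset ?_)
    rintro ℓ (rfl | hℓ | hℓ)
    · exact Set.mem_setOf.mpr (le_max_left _ _)
    · exact Set.mem_setOf.mpr (le_max_of_le_right (le_max_of_le_left
        (Nat.le_of_dvd (Int.natAbs_pos.mpr hΔ0) (Int.natCast_dvd.mp hℓ))))
    · exact Set.mem_setOf.mpr (le_max_of_le_right (le_max_of_le_right
        (Nat.le_of_dvd (Nat.pos_of_neZero M) hℓ)))
  -- Chebotarev for `ρ` and `σ`, outside the places over `S'`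
  obtain ⟨v, ⟨-, 𝔓, h𝔓, Φ, hΦ, hρ⟩, hvB⟩ :=
    (FramedArtinRep.infinite_setOf_isArithFrobAt_apply_eq ρ σ).exists_notMem_finite
      (finite_setOf_place_over S' hS')
  obtain ⟨ℓ, hℓ, hℓv⟩ := exists_prime_natCast_mem v
  have hℓS' : ℓ ∉ S' := fun hmem ↦ hvB (Set.mem_biUnion (x := ℓ) ⟨hmem, hℓ.ne_zero⟩ hℓv)
  have hℓS : ℓ ∉ S := fun h ↦ hℓS' (Or.inl h)
  have hℓp : ℓ ≠ 3 := fun h ↦ hℓS' (Or.inr (Or.inl h))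
  have hℓΔ : ¬ (ℓ : ℤ) ∣ minimalDiscriminantInt W := fun h ↦ hℓS' (Or.inr (Or.inr (Or.inl h)))
  have hℓM : ¬ ℓ ∣ M := fun h ↦ hℓS' (Or.inr (Or.inr (Or.inr h)))
  haveI : Fact ℓ.Prime := ⟨hℓ⟩
  have hgood : W.HasGoodReductionAtPrime ℓ := hasGoodReductionAtPrime_of_not_dvd W ℓ hℓΔ
  -- `ρ Φ = ρ σ`: `Φ = σ` on `E[3]` and `χ Φ = χ σ = u`
  obtain ⟨hΦP, hΦχ⟩ := hfaith Φ σ hρ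
  have hχΦ : χ Φ = u := by rw [hΦχ, ← hχdef, hσχ]
  refine ⟨ℓ, ⟨hℓ⟩, hℓS, hℓp, hgood, ?_, fun hdvd ↦ ?_⟩
  · -- `ℓ ≡ u (mod M)` from `χ_M(Φ) = ℓ`
    have hprimes : ((Rat.HeightOneSpectrum.primesEquiv v : Nat.Primes) : ℕ) = ℓ :=
      primesEquiv_eq_of_natCast_mem hℓ hℓv
    have hMP : (M : absIntegers (𝓞 ℚ) ℚ) ∉ 𝔓 :=
      Rat.natCast_not_mem_of_mem_primesAbove_of_not_dvd h𝔓 (by rw [hprimes]; exact hℓM)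
    have h1 := modNCyclotomicCharacter_eq_residueCard_of_isArithFrobAt h𝔓 hMP hΦ
    rw [← hχdef, hχΦ, residueCard_eq_of_natCast_mem hℓ hℓv] at h1
    exact h1.symm
  · -- `3 ∣ #Ẽ(𝔽_ℓ)` would give a non-zero fixed point of `Φ`, hence of `σ`
    obtain ⟨P, hP0, hP⟩ :=
      exists_frobenius_smul_eq_of_dvd_reductionPointCount_holds W 3 ℓ hℓp hgood hdvd v hℓv 𝔓 h𝔓
        Φ hΦ
    have hσP : σ • P = P := by rw [← hΦP P, hP]
    exact hP0 (hσ P hσP)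

/-- The same with the trace of Frobenius: a good prime `q ≡ u (mod M)`, `q ∉ S`, `q ≠ 3`, with
`a_q(E) ≢ q + 1 (mod 3)` (`dvd_frobeniusTrace_sub_iff`). [cite: TateGCFT1967, §2.4] -/
theorem exists_prime_cast_eq_not_dvd_frobeniusTrace_sub_of_surj [W.IsGloballyMinimal]
    (hs : W.HasSurjectiveModNGaloisRep (3 : ℕ)) (M : ℕ) [NeZero M] (u : (ZMod M)ˣ)
    (S : Set ℕ) (hS : S.Finite) :
    ∃ (ℓ : ℕ) (_ : Fact ℓ.Prime), ℓ ∉ S ∧ ℓ ≠ 3 ∧ W.HasGoodReductionAtPrime ℓ ∧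
      (ℓ : ZMod M) = (u : ZMod M) ∧ ¬ (3 : ℤ) ∣ W.frobeniusTrace ℓ - (ℓ + 1) := by
  obtain ⟨ℓ, hℓ, hS', hℓp, hgood, hu, hndvd⟩ :=
    exists_prime_cast_eq_not_dvd_reductionPointCount_of_surj W hs M u S hS
  exact ⟨ℓ, hℓ, hS', hℓp, hgood, hu, fun h ↦ hndvd ((dvd_frobeniusTrace_sub_iff W 3 ℓ).mp
    (by exact_mod_cast h))⟩

end Summit.BirchSwinnertonDyer.BirchSwinnertonDyer.Theorems.KimAtThreePortSharedC2Chebotarev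

end
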